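import Mathlib.Algebra.Group.Basic
import Mathlib.Data.Finset.Defs
import Mathlib.Data.Fin.Rev

/-!
# Ladder duality `isLadder_reverse` — explicit / elementary route (siege attempt k14)

Item `stmt-MatrixMultiplication-14308` (`FourierTwoFamiliesModP.PrimeTwoFamilies`, CKSU 2005
Conj. 4.7 with prime cyclic hosts), line `Sketch`, registered stub `isLadder_reverse`.

A *ladder* is an ordered family `(X c, Y c)_{c < r}` of finite subsets of an additive commutative
group with

* (directness, `hW`) every class is direct: for `x, x' ∈ X c`, `y, y' ∈ Y c`,
  `(x - x') + (y - y') = 0` forces `x = x'` and `y = y'`;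
* (one-directional separation, `hL`) for `p < q` the lower cross differences `y' - x'`
  (`x' ∈ X p`, `y' ∈ Y q`) avoid every diagonal difference `y - x` (`x ∈ X c`, `y ∈ Y c`).

The stub says that `c ↦ (Y (Fin.rev c), X (Fin.rev c))` is again a ladder.  This file proves it by
making the two elementary symmetries behind it EXPLICIT, each stated for an arbitrary index type
and an arbitrary relation on it (so that each is visibly an involution / a functoriality):

1. `sub_eq_sub_iff_cross`, `sub_eq_sub_swap_iff` — a coincidence of two differences
   `y - x = y' - x'` is the cross-sum relation `x' + y = x + y'`, hence is symmetric under
   exchanging the roles of the two sides (`x - y = x' - y'`);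
2. `direct_swap` — directness of ONE class `(S, T)` is symmetric in `S`, `T`;
3. `sep_swap` — swapping the sides of a family separated over the pairs of a relation `R`
   yields a family separated over the REVERSED pairs (`R q p`): ascending ladders become
   descending ladders;
4. `sep_comap`, `direct_comap` — both clauses pull back along any re-indexing map carrying a
   relation `S` into `R`; the order-reversing involution `Fin.rev` carries `<` into `>`
   (`Fin.rev_lt_rev`), so it turns descending ladders back into ascending ones.

`isLadder_reverse` (the registered signature, verbatim) is the composite of 2–4, and
`isLadder_reverse_iff` records that the duality is an involution up to `Fin.rev_rev`, i.e. an
equivalence between ladders and reversed dual ladders.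

Design: Mathlib-only (`Mathlib.Algebra.Group.Basic`, `Mathlib.Data.Finset.Defs`,
`Mathlib.Data.Fin.Rev`), term-mode proofs, no new definitions (the ladder clauses stay inlined
exactly as in the route's registered stubs).  Deliberately NOT here: anything about the sizes
`|X c|·|Y c|` or the host group (see the line's packing / shape files).  An independent one-shot
proof of the same stub by the round-1 lead is `…Theorems.PrimeTwoFamilies.LadderLift.isLadder_reverse`
(`FourierTwoFamiliesModPPrimeTwoFamiliesLadderReverse.lean`); this file shares no code with it.
-/

-- single-conjunct summit: the mandated namespace repeats `MatrixMultiplication` (summit = sub-problem).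
set_option linter.dupNamespace false

namespace Summit.MatrixMultiplication.MatrixMultiplication.Theorems.PrimeTwoFamilies.LadderReverseK14

section Algebra

variable {G : Type*} [AddCommGroup G]

/-- **Cross-sum form of a coincidence of differences** [folklore].  In an additive commutative
group, `y - x = y' - x'` holds iff `x' + y = x + y'`. -/
theorem sub_eq_sub_iff_cross (x y x' y' : G) : y - x = y' - x' ↔ x' + y = x + y' := by
  rw [sub_eq_sub_iff_add_eq_add, add_comm y x', add_comm y' x]

/-- **Side swap for coincidences of differences** [folklore].  `y - x = y' - x'` iff
`x - y = x' - y'`: both are the cross-sum relation `x' + y = x + y'` read from either side. -/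
theorem sub_eq_sub_swap_iff (x y x' y' : G) : y - x = y' - x' ↔ x - y = x' - y' := by
  rw [sub_eq_sub_iff_cross, sub_eq_sub_iff_add_eq_add]
  exact eq_comm

/-- **Directness of one class is side-symmetric** [folklore].  If `(S, T)` is direct
(`(x - x') + (y - y') = 0` with `x, x' ∈ S`, `y, y' ∈ T` forces `x = x'`, `y = y'`), then so is
`(T, S)`; the two summands are simply commuted. -/
theorem direct_swap {S T : Finset G}
    (h : ∀ x ∈ S, ∀ x' ∈ S, ∀ y ∈ T, ∀ y' ∈ T, (x - x') + (y - y') = 0 → x = x' ∧ y = y') :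
    ∀ y ∈ T, ∀ y' ∈ T, ∀ x ∈ S, ∀ x' ∈ S, (y - y') + (x - x') = 0 → y = y' ∧ x = x' :=
  fun y hy y' hy' x hx x' hx' h0 => (h x hx x' hx' y hy y' hy' ((add_comm _ _).trans h0)).symm

/-- Directness of one class `(S, T)` is EQUIVALENT to directness of the swapped class `(T, S)`
(`direct_swap` in both directions) [folklore]. -/
theorem direct_swap_iff (S T : Finset G) :
    (∀ x ∈ S, ∀ x' ∈ S, ∀ y ∈ T, ∀ y' ∈ T, (x - x') + (y - y') = 0 → x = x' ∧ y = y') ↔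
    (∀ y ∈ T, ∀ y' ∈ T, ∀ x ∈ S, ∀ x' ∈ S, (y - y') + (x - x') = 0 → y = y' ∧ x = x') :=
  ⟨direct_swap, direct_swap⟩

variable {ι κ : Type*}

/-- **Re-indexing directness** [folklore].  Class-wise directness of a family `(X c, Y c)_{c : ι}`
pulls back along any map `e : κ → ι` of the index types. -/
theorem direct_comap (e : κ → ι) (X Y : ι → Finset G)
    (h : ∀ c, ∀ x ∈ X c, ∀ x' ∈ X c, ∀ y ∈ Y c, ∀ y' ∈ Y c,
      (x - x') + (y - y') = 0 → x = x' ∧ y = y') :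
    ∀ c, ∀ x ∈ X (e c), ∀ x' ∈ X (e c), ∀ y ∈ Y (e c), ∀ y' ∈ Y (e c),
      (x - x') + (y - y') = 0 → x = x' ∧ y = y' :=
  fun c => h (e c)

/-- **Swapping sides reverses the separation order** [folklore].  Let `R` be any relation on the
index type.  If for every `R`-pair `(p, q)` the cross differences `y' - x'` (`x' ∈ X p`,
`y' ∈ Y q`) avoid all diagonal differences `y - x` (`x ∈ X c`, `y ∈ Y c`) of the family `(X, Y)`,
then the swapped family `(Y, X)` has the same property over the REVERSED pairs `(q, p)`:
negating a difference exchanges the two sides (`sub_eq_sub_swap_iff`).  For `R = (<)` on `Fin r`: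
the side swap of an ascending ladder is a descending ladder. -/
theorem sep_swap (R : ι → ι → Prop) (X Y : ι → Finset G)
    (h : ∀ c p q, R p q → ∀ x ∈ X c, ∀ y ∈ Y c, ∀ x' ∈ X p, ∀ y' ∈ Y q, y - x ≠ y' - x') :
    ∀ c p q, R q p → ∀ x ∈ Y c, ∀ y ∈ X c, ∀ x' ∈ Y p, ∀ y' ∈ X q, y - x ≠ y' - x' :=
  fun c p q hqp x hx y hy x' hx' y' hy' e =>
    h c q p hqp y hy x hx y' hy' x' hx' ((sub_eq_sub_swap_iff x y x' y').1 e)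

/-- **Re-indexing separation** [folklore].  If `e : κ → ι` carries a relation `S` on `κ` into a
relation `R` on `ι` (`S p q → R (e p) (e q)`), then a family separated over `R`-pairs pulls back
along `e` to a family separated over `S`-pairs.  For `e = Fin.rev`, `S = (<)`, `R = (>)`
(`Fin.rev_lt_rev`): re-indexing a descending ladder along `Fin.rev` gives an ascending ladder. -/
theorem sep_comap (R : ι → ι → Prop) (S : κ → κ → Prop) (e : κ → ι)
    (he : ∀ p q, S p q → R (e p) (e q)) (X Y : ι → Finset G)
    (h : ∀ c p q, R p q → ∀ x ∈ X c, ∀ y ∈ Y c, ∀ x' ∈ X p, ∀ y' ∈ Y q, y - x ≠ y' - x') :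
    ∀ c p q, S p q → ∀ x ∈ X (e c), ∀ y ∈ Y (e c), ∀ x' ∈ X (e p), ∀ y' ∈ Y (e q),
      y - x ≠ y' - x' :=
  fun c p q hpq => h (e c) (e p) (e q) (he p q hpq)

end Algebra

/-- **Ladder duality** (registered stub `isLadder_reverse` of crux `PrimeTwoFamilies`, line
`Sketch`).  If `(X c, Y c)_{c < r}` is a ladder — every class direct (`hW`) and one-directionally
separated (`hL`) — then so is the family obtained by swapping the two sides and reversing the class
order, `c ↦ (Y (Fin.rev c), X (Fin.rev c))`.

Explicit route: directness is swapped class by class (`direct_swap`) and re-indexed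
(`direct_comap`); separation is swapped into DESCENDING separation (`sep_swap` with `R = (<)`) and
pulled back along the order-reversing involution `Fin.rev`, which carries `<` into `>`
(`sep_comap` with `Fin.rev_lt_rev`). -/
theorem isLadder_reverse {G : Type*} [AddCommGroup G] {r : ℕ} (X Y : Fin r → Finset G)
    (hW : ∀ c : Fin r, ∀ x ∈ X c, ∀ x' ∈ X c, ∀ y ∈ Y c, ∀ y' ∈ Y c,
      (x - x') + (y - y') = 0 → x = x' ∧ y = y')
    (hL : ∀ c p q : Fin r, p < q → ∀ x ∈ X c, ∀ y ∈ Y c, ∀ x' ∈ X p, ∀ y' ∈ Y q,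
      y - x ≠ y' - x') :
    (∀ c : Fin r, ∀ x ∈ Y (Fin.rev c), ∀ x' ∈ Y (Fin.rev c), ∀ y ∈ X (Fin.rev c),
        ∀ y' ∈ X (Fin.rev c), (x - x') + (y - y') = 0 → x = x' ∧ y = y') ∧
    (∀ c p q : Fin r, p < q → ∀ x ∈ Y (Fin.rev c), ∀ y ∈ X (Fin.rev c),
        ∀ x' ∈ Y (Fin.rev p), ∀ y' ∈ X (Fin.rev q), y - x ≠ y' - x') :=
  ⟨direct_comap Fin.rev Y X fun c => direct_swap (hW c),
    sep_comap (fun p q : Fin r => q < p) (· < ·) Fin.rev (fun _ _ hpq => Fin.rev_lt_rev.2 hpq) Y X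
      (sep_swap (· < ·) X Y hL)⟩

/-- **The duality is an involution** [folklore].  Since `Fin.rev (Fin.rev c) = c`, applying
`isLadder_reverse` to the reversed dual family returns the original one; hence `(X, Y)` is a
ladder iff its reversed dual `c ↦ (Y (Fin.rev c), X (Fin.rev c))` is a ladder. -/
theorem isLadder_reverse_iff {G : Type*} [AddCommGroup G] {r : ℕ} (X Y : Fin r → Finset G) :
    ((∀ c : Fin r, ∀ x ∈ X c, ∀ x' ∈ X c, ∀ y ∈ Y c, ∀ y' ∈ Y c,
        (x - x') + (y - y') = 0 → x = x' ∧ y = y') ∧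
      (∀ c p q : Fin r, p < q → ∀ x ∈ X c, ∀ y ∈ Y c, ∀ x' ∈ X p, ∀ y' ∈ Y q,
        y - x ≠ y' - x')) ↔
    ((∀ c : Fin r, ∀ x ∈ Y (Fin.rev c), ∀ x' ∈ Y (Fin.rev c), ∀ y ∈ X (Fin.rev c),
        ∀ y' ∈ X (Fin.rev c), (x - x') + (y - y') = 0 → x = x' ∧ y = y') ∧
      (∀ c p q : Fin r, p < q → ∀ x ∈ Y (Fin.rev c), ∀ y ∈ X (Fin.rev c),
        ∀ x' ∈ Y (Fin.rev p), ∀ y' ∈ X (Fin.rev q), y - x ≠ y' - x')) := by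
  refine ⟨fun h => isLadder_reverse X Y h.1 h.2, fun h => ?_⟩
  have h2 := isLadder_reverse (fun c => Y (Fin.rev c)) (fun c => X (Fin.rev c)) h.1 h.2
  simpa only [Fin.rev_rev] using h2

end Summit.MatrixMultiplication.MatrixMultiplication.Theorems.PrimeTwoFamilies.LadderReverseK14
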